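import Literature.MathematicalPhysics.QuantumLattice.HubbardTTPrimeTPPInteraction
import Literature.MathematicalPhysics.QuantumLattice.HubbardGaugeBoundSharp
import HarnessLib

/-!
# The sharp norm of a two-spin hopping bond, `‖−t Σ_σ (c†_{aσ} c_{bσ} + h.c.)‖ ≤ 2|t|`, and the
# halved Lipschitz constant of the ground-state energy density in `t''` (and per `t`, `t'` bond)

Topic `Literature/MathematicalPhysics/QuantumLattice`. The tree's generic bond estimate
`norm_hoppingTerm_le` (`InfVolFermionStateBounds`) uses `‖c‖, ‖c†‖ ≤ 1` termwise and gives `4|t|` per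
two-spin bond; Koma–Tasaki's remark after eq. (11) of PRL 68 (1992) 3248 — `‖c†_a c_b + c†_b c_a‖ = 1` for
distinct orbitals, in the tree as `norm_hopping_le_one` (`HubbardGaugeBoundSharp`) — gives `2|t|`. This
file records the sharp bond norm in the `cAt`/`fermionEmbed` format of the infinite-volume fermion
interactions and its consequences:

* `norm_hoppingTerm_le_two_mul` — `‖−t Σ_σ ((c_{aσ})ᴴ c_{bσ} + (c_{bσ})ᴴ c_{aσ})‖ ≤ 2|t|` when `a σ ≠ b σ`.
* `norm_fermionEmbed_hubbard_pair_le_two_mul`, `norm_fermionEmbed_diagHopping_pair_le_two_mul`,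
  `norm_fermionEmbed_axialRange2Hopping_pair_le_two_mul` — every embedded nearest-neighbour / diagonal /
  axial range-2 bond term has norm `≤ 2|t|`, `2|t'|`, `2|t''|`.
* `norm_meanEnergyObs_axialRange2Hopping_le_two_mul` — `‖E_{Φ''}‖ ≤ 2 d |t''|` (was `4 d |t''|`), hence
  `abs_tiGroundEnergyDensity_tpp_sub_le_four_mul` — on `ℤ²`, `|e₀(t, t', t'', U) − e₀(t, t', s'', U)| ≤ 4|t'' − s''|`
  and `abs_tiGroundEnergyDensity_tpp_sub_ttPrime_le_four_mul` — the one-body truncation residual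
  `|e₀(t, t', t'', U) − e₀(t, t', U)| ≤ 4|t''|` (range parameter `2`), half the constant of
  `HubbardTTPrimeTPPInteraction`.

Written for the Hubbard material-oracle programme (cell `pub/hubbard-downfold`, seat hubbard-downfold-mod-1:
the generic constant `C` of the typed S1/S2 (T1) rule `Downfold.holdsOn_inflate_of_lipschitz`). HONEST
SCOPE: still the operator-norm route — the sharp kinematic constant `16/π² ≈ 1.62` per unit `t''` (free
dispersion, Lieb–Loss bathtub) is NOT claimed. Everything is PROVED; no definition.

## References
* T. Koma, H. Tasaki, Phys. Rev. Lett. 68 (1992) 3248, remark after eq. (11) (`‖c†_x c_y + c†_y c_x‖ = 1`).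
  [cite: KomaTasakiPRL1992, eq. (11) remark]
* R. B. Israel, *Convexity in the theory of lattice gases* (1979), Thm. I.3.4. [cite: Israel1979, Thm. I.3.4]
* O. Bratteli, D. W. Robinson, *Operator Algebras and Quantum Statistical Mechanics 1* (1987), Prop. 2.3.11.
  [cite: BratteliRobinsonI1987, Prop. 2.3.11]
-/

noncomputable section

namespace Literature.MathematicalPhysics.QuantumLattice

open Matrix Finset HubbardWave0 Literature.Probability.LatticeModels
open scoped Matrix.Norms.L2Operator

variable {d : ℕ}

/-! ### The sharp two-spin bond norm -/

section Bond

variable {ι : Type*} [LinearOrder ι] [Fintype ι]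

/-- **A two-spin hopping bond has norm `≤ 2|t|`**: for orbitals `a σ ≠ b σ` (`σ = 0, 1`),
`‖−t Σ_σ ((c_{aσ})ᴴ c_{bσ} + (c_{bσ})ᴴ c_{aσ})‖ ≤ 2|t|` — each summand is Koma–Tasaki's symmetric hopping
operator of norm `≤ 1`. [cite: KomaTasakiPRL1992, eq. (11) remark] -/
theorem norm_hoppingTerm_le_two_mul (t : ℝ) (a b : Fin 2 → ι) (hab : ∀ σ, a σ ≠ b σ) :
    ‖-(t : ℂ) • ∑ σ : Fin 2,
        ((annihilation (a σ) : Matrix (Finset ι) (Finset ι) ℂ)ᴴ * annihilation (b σ) +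
          (annihilation (b σ))ᴴ * annihilation (a σ))‖ ≤ 2 * |t| := by
  have hterm : ∀ σ : Fin 2, ‖((annihilation (a σ) : Matrix (Finset ι) (Finset ι) ℂ)ᴴ * annihilation (b σ) +
      (annihilation (b σ))ᴴ * annihilation (a σ))‖ ≤ 1 := by
    intro σ
    rw [annihilation_conjTranspose, annihilation_conjTranspose]
    exact norm_hopping_le_one (hab σ)
  rw [norm_smul, norm_neg, Complex.norm_real, Real.norm_eq_abs]
  calc |t| * ‖∑ σ : Fin 2, (((annihilation (a σ) : Matrix (Finset ι) (Finset ι) ℂ)ᴴ * annihilation (b σ) +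
        (annihilation (b σ))ᴴ * annihilation (a σ)))‖
      ≤ |t| * ∑ σ : Fin 2, ‖((annihilation (a σ) : Matrix (Finset ι) (Finset ι) ℂ)ᴴ * annihilation (b σ) +
        (annihilation (b σ))ᴴ * annihilation (a σ))‖ :=
        mul_le_mul_of_nonneg_left (norm_sum_le _ _) (abs_nonneg t)
    _ ≤ |t| * ∑ _σ : Fin 2, (1 : ℝ) :=
        mul_le_mul_of_nonneg_left (Finset.sum_le_sum fun σ _ => hterm σ) (abs_nonneg t)
    _ = 2 * |t| := by simp; ring

end Bond

/-! ### Embedded bond terms of the `t`, `t'`, `t''` interactions -/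

section Embedded

/-- Distinct sites of a region give distinct orbitals of the same spin. [folklore] -/
private theorem orb_pt_ne {Λ : Finset (Site d)} {x y : Site d} (hx : x ∈ Λ) (hy : y ∈ Λ) (hxy : x ≠ y)
    (σ : Fin 2) : orb (PolySite.pt x hx) σ ≠ orb (PolySite.pt y hy) σ := by
  intro h
  have h1 := (orb_inj.1 h).1
  have h2 := congrArg (fun p : PolySite Λ => ofLex p.1) h1
  simp only [PolySite.ofLex_coe_pt] at h2
  exact hxy h2

/-- **An embedded nearest-neighbour bond term of the Hubbard interaction has norm `≤ 2|t|`.**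
[cite: KomaTasakiPRL1992, eq. (11) remark] -/
theorem norm_fermionEmbed_hubbard_pair_le_two_mul (t U : ℝ) {Λ' : Finset (Site d)} (x : Site d) (i : Fin d)
    (h : ({x, x + unitVec i} : Finset (Site d)) ⊆ Λ') :
    ‖fermionEmbed (PolySite.incl h) ((hubbardFermionInteraction d t U).Φ {x, x + unitVec i})‖ ≤ 2 * |t| := by
  rw [hubbardFermionInteraction_apply_pair, fermionEmbed_smul, fermionEmbed_sum]
  simp only [fermionEmbed_add, fermionEmbed_mul, fermionEmbed_conjTranspose, fermionEmbed_incl_cAt]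
  exact norm_hoppingTerm_le_two_mul t (fun σ => orb (PolySite.pt x (h (mem_insert_self _ _))) σ)
    (fun σ => orb (PolySite.pt (x + unitVec i) (h (mem_insert_of_mem (mem_singleton_self _)))) σ)
    fun σ => orb_pt_ne _ _ (self_ne_add_unitVec x i) σ

/-- **An embedded diagonal bond term has norm `≤ 2|t'|`.** [cite: KomaTasakiPRL1992, eq. (11) remark] -/
theorem norm_fermionEmbed_diagHopping_pair_le_two_mul (t' : ℝ) {Λ' : Finset (Site 2)} (x : Site 2) (s : Fin 2)
    (h : ({x, x + diagVec s} : Finset (Site 2)) ⊆ Λ') :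
    ‖fermionEmbed (PolySite.incl h) ((diagHoppingFermionInteraction t').Φ {x, x + diagVec s})‖ ≤ 2 * |t'| := by
  rw [diagHoppingFermionInteraction_apply_pair, fermionEmbed_smul, fermionEmbed_sum]
  simp only [fermionEmbed_add, fermionEmbed_mul, fermionEmbed_conjTranspose, fermionEmbed_incl_cAt]
  exact norm_hoppingTerm_le_two_mul t' (fun σ => orb (PolySite.pt x (h (mem_insert_self _ _))) σ)
    (fun σ => orb (PolySite.pt (x + diagVec s) (h (mem_insert_of_mem (mem_singleton_self _)))) σ)
    fun σ => orb_pt_ne _ _ (self_ne_add_diagVec x s) σ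

/-- **An embedded axial range-2 bond term has norm `≤ 2|t''|`.** [cite: KomaTasakiPRL1992, eq. (11) remark] -/
theorem norm_fermionEmbed_axialRange2Hopping_pair_le_two_mul (t'' : ℝ) {Λ' : Finset (Site d)} (x : Site d)
    (i : Fin d) (h : ({x, x + axial2Vec i} : Finset (Site d)) ⊆ Λ') :
    ‖fermionEmbed (PolySite.incl h) ((axialRange2HoppingFermionInteraction d t'').Φ {x, x + axial2Vec i})‖ ≤
      2 * |t''| := by
  rw [axialRange2HoppingFermionInteraction_apply_pair, fermionEmbed_smul, fermionEmbed_sum]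
  simp only [fermionEmbed_add, fermionEmbed_mul, fermionEmbed_conjTranspose, fermionEmbed_incl_cAt]
  exact norm_hoppingTerm_le_two_mul t'' (fun σ => orb (PolySite.pt x (h (mem_insert_self _ _))) σ)
    (fun σ => orb (PolySite.pt (x + axial2Vec i) (h (mem_insert_of_mem (mem_singleton_self _)))) σ)
    fun σ => orb_pt_ne _ _ (self_ne_add_axial2Vec x i) σ

end Embedded

/-! ### The halved Lipschitz constant in `t''` -/

section Lipschitz

variable (t'' : ℝ)

/-- **`‖E_{Φ''}‖ ≤ 2 d |t''|`** (the `2d` half-bonds through the origin have norm `≤ 2|t''|` each).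
[cite: BratteliRobinsonI1987, Prop. 2.3.11] -/
theorem norm_meanEnergyObs_axialRange2Hopping_le_two_mul :
    ‖(axialRange2HoppingFermionInteraction d t'').meanEnergyObs 2‖ ≤ 2 * d * |t''| := by
  rw [axialRange2HoppingFermionInteraction_meanEnergyObs]
  have hhalf : ‖(2 : ℂ)⁻¹‖ = 2⁻¹ := by simp
  have hterm : ∀ i : Fin d,
      ‖(2 : ℂ)⁻¹ • fermionEmbed (PolySite.incl (pair_axial2Vec_subset_thicken_two i))
            ((axialRange2HoppingFermionInteraction d t'').Φ {0, 0 + axial2Vec i}) +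
          (2 : ℂ)⁻¹ • fermionEmbed (PolySite.incl (pair_neg_axial2Vec_subset_thicken_two i))
            ((axialRange2HoppingFermionInteraction d t'').Φ {-axial2Vec i, -axial2Vec i + axial2Vec i})‖ ≤
        2 * |t''| := by
    intro i
    refine (norm_add_le _ _).trans ?_
    rw [norm_smul, norm_smul, hhalf]
    have h1 := norm_fermionEmbed_axialRange2Hopping_pair_le_two_mul t'' (0 : Site d) i
      (pair_axial2Vec_subset_thicken_two i)
    have h2 := norm_fermionEmbed_axialRange2Hopping_pair_le_two_mul t'' (-axial2Vec i : Site d) i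
      (pair_neg_axial2Vec_subset_thicken_two i)
    linarith
  calc _ ≤ ∑ i : Fin d, ‖(2 : ℂ)⁻¹ • fermionEmbed (PolySite.incl (pair_axial2Vec_subset_thicken_two i))
            ((axialRange2HoppingFermionInteraction d t'').Φ {0, 0 + axial2Vec i}) +
          (2 : ℂ)⁻¹ • fermionEmbed (PolySite.incl (pair_neg_axial2Vec_subset_thicken_two i))
            ((axialRange2HoppingFermionInteraction d t'').Φ {-axial2Vec i, -axial2Vec i + axial2Vec i})‖ :=
        norm_sum_le _ _
    _ ≤ ∑ _i : Fin d, 2 * |t''| := Finset.sum_le_sum fun i _ => hterm i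
    _ = 2 * d * |t''| := by rw [Finset.sum_const, Finset.card_univ, Fintype.card_fin, nsmul_eq_mul]; ring

end Lipschitz

section LipschitzTT

variable (t t' t'' U : ℝ)

/-- **Lipschitz continuity in `t''` with the halved constant** (range parameter `2`):
`|e₀(t, t', t'', U) − e₀(t, t', s'', U)| ≤ 4 |t'' − s''|` (`‖E_{Φ''(1)}‖ ≤ 2·2·1`).
[cite: Israel1979, Thm. I.3.4] -/
theorem abs_tiGroundEnergyDensity_tpp_sub_le_four_mul (s'' : ℝ) :
    |(hubbardTT'T''FermionInteraction t t' t'' U).tiGroundEnergyDensity 2 -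
        (hubbardTT'T''FermionInteraction t t' s'' U).tiGroundEnergyDensity 2| ≤ 4 * |t'' - s''| := by
  refine (abs_tiGroundEnergyDensity_tpp_sub_le t t' t'' U 2 s'').trans ?_
  have h := norm_meanEnergyObs_axialRange2Hopping_le_two_mul (d := 2) (1 : ℝ)
  rw [abs_one, mul_one, Nat.cast_ofNat] at h
  have h4 : ‖(axialRange2HoppingFermionInteraction 2 1).meanEnergyObs 2‖ ≤ 4 := by linarith
  exact mul_le_mul_of_nonneg_right h4 (abs_nonneg _)

/-- **The truncation residual with the halved constant**: dropping `t''` moves the translation-invariant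
ground-state energy density by at most `4|t''|` (range parameter `2`):
`|e₀(t, t', t'', U) − e₀(t, t', U)| ≤ 4|t''|`. [cite: Israel1979, Thm. I.3.4] -/
theorem abs_tiGroundEnergyDensity_tpp_sub_ttPrime_le_four_mul :
    |(hubbardTT'T''FermionInteraction t t' t'' U).tiGroundEnergyDensity 2 -
        (hubbardTTPrimeFermionInteraction t t' U).tiGroundEnergyDensity 2| ≤ 4 * |t''| := by
  have h := abs_tiGroundEnergyDensity_tpp_sub_le_four_mul t t' t'' U 0
  rwa [hubbardTT'T''FermionInteraction_zero, sub_zero] at h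

end LipschitzTT

end Literature.MathematicalPhysics.QuantumLattice

end
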